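import Literature.RingTheory.PBasis.KimuraNiitsuma1980
import HarnessLib

/-!
# Route `RadicialJung`, crux `CleanModels` (stmt-15917): the monomial expansion along a `p`-basis
# (Giraud 1983 §1.4 (2) over an arbitrary field — input layer (P1) of `K2-DESIGN.md` §5.7)

Support file (OURS; general algebra) for PROGRAMME-clean-dim2 (K2 step 2.6 = Giraud's Lemme 2.3
(iii), W8.1). Giraud, Bull. SMF 111 (1983), 1.4 (2) and 2.6 (2) (p. 119): every `f` of the regular
local ring is expanded as `f = Σ_{(i,j,b)} f_{ijb}^p xⁱ yʲ u^b`, `0 ≤ i, j, b_λ < p`, along the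
"coordonnées différentielles" `(x, y, u₁, …, u_k)` — a `p`-basis; over a NON-`F`-finite field the
`p`-basis is infinite (Kimura–Niitsuma 1980, Thm. 3.4, typed as the named fact
`Literature.RingTheory.PBasis.KimuraNiitsuma1980_thm_3_4`) and the expansion is finitely supported.
Here, for Kimura–Niitsuma's printed notion `IsPBasisOver p R′ Γ` (`R′[Γ] = R` and the reduced
monomials in any finitely many elements of `Γ` are `R′`-linearly independent; `Γ` possibly infinite):

* `IsPBasisOver.linearIndependent_monomial` — the REDUCED MONOMIALS `Γ^b = ∏ γ^{b γ}`
  (`b : Γ →₀ ℕ` finitely supported with all `b γ < p`) are `R′`-linearly independent as ONE family;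
* `IsPBasisOver.span_monomial_eq_top` — for `R′ = R^p` (the range of Frobenius) they SPAN `R` over
  `R′` (reduce exponents: `γ · Γ^b` is a reduced monomial or `γ^p ·` one, `γ^p ∈ R^p`);
* `IsPBasisOver.exists_monomial_expansion` — hence every `f ∈ R` is a finite sum
  `f = Σ_b c_b · Γ^b` with `c_b ∈ R^p`, i.e. `f = Σ_b f_b^p Γ^b` (Giraud's (2)); with the linear
  independence the coefficients are unique (`Basis.mk` on the two theorems).

References: T. Kimura, H. Niitsuma, J. Math. Soc. Japan 32 (1980), p. 363 (definition)
[KimuraNiitsuma1980]; J. Giraud, Bull. SMF 111 (1983), 1.4 (2), 2.6 (2) [Giraud1983]. Nothing here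
is a statement of Hironaka's manuscript or bears on the summit directly.
-/

noncomputable section

set_option linter.dupNamespace false -- mandated namespace of this single-conjunct summit

open Literature.RingTheory.PBasis

namespace Summit.ResolutionOfSingularities.ResolutionOfSingularities.Theorems.RadicialJung.CleanModels

universe u

variable {p : ℕ} {R : Type u} [CommRing R]

/-- **The reduced monomials of a `p`-basis are linearly independent as one family.** For
`IsPBasisOver p R′ Γ` (Kimura–Niitsuma, p. 363: for every finite `{b₁,…,b_s} ⊆ Γ` the monomials
`∏ bᵢ^{nᵢ}`, `0 ≤ nᵢ < p`, are `R′`-independent), the whole family of reduced monomials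
`Γ^b = ∏_{γ} γ^{b γ}`, indexed by the finitely supported `b : Γ →₀ ℕ` with `b γ < p`, is
`R′`-linearly independent (a finite subfamily only involves finitely many elements of `Γ`).
[cite: KimuraNiitsuma1980, p. 363 l. 7–10] -/
theorem IsPBasisOver.linearIndependent_monomial {R' : Subring R} {Γ : Set R}
    (h : IsPBasisOver p R' Γ) :
    LinearIndependent R'
      (fun b : {b : Γ →₀ ℕ // ∀ γ, b γ < p} => (b.1).prod fun γ n => ((γ : Γ) : R) ^ n) := by
  classical
  rw [linearIndependent_iff_finset_linearIndependent]
  intro s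
  -- the finitely many elements of `Γ` involved
  set G : Finset Γ := s.biUnion fun b => b.1.support with hG
  have hsub : ∀ b ∈ s, b.1.support ⊆ G := fun b hb =>
    Finset.subset_biUnion_of_mem (fun b : {b : Γ →₀ ℕ // ∀ γ, b γ < p} => b.1.support) hb
  set k := G.card
  let e : ↥G ≃ Fin k := G.equivFin
  let bv : Fin k → R := fun i => (((e.symm i : ↥G) : Γ) : R)
  have hbinj : Function.Injective bv := by
    intro i j hij
    have : (e.symm i : ↥G) = e.symm j := Subtype.ext (Subtype.ext hij)
    exact e.symm.injective this
  have hbΓ : ∀ i, bv i ∈ Γ := fun i => (((e.symm i : ↥G) : Γ)).2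
  have hli := h.2 k bv hbinj hbΓ
  -- exponent vectors of the subfamily, as functions on `Fin k`
  let φ : ↥s → (Fin k → Fin p) := fun b i =>
    ⟨b.1.1 ((e.symm i : ↥G) : Γ), b.1.2 _⟩
  have hφ : Function.Injective φ := by
    intro b b' hbb'
    apply Subtype.ext
    apply Subtype.ext
    ext γ
    by_cases hγ : γ ∈ G
    · have := congrArg (fun f : Fin k → Fin p => (f (e ⟨γ, hγ⟩) : ℕ)) hbb'
      simpa [φ] using this
    · have h1 : γ ∉ b.1.1.support := fun hm => hγ (hsub b.1 b.2 hm)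
      have h2 : γ ∉ b'.1.1.support := fun hm => hγ (hsub b'.1 b'.2 hm)
      rw [Finsupp.notMem_support_iff.mp h1, Finsupp.notMem_support_iff.mp h2]
  -- the subfamily is the Kimura–Niitsuma family composed with `φ`
  have heq : (fun b : {b : Γ →₀ ℕ // ∀ γ, b γ < p} => (b.1).prod fun γ n => ((γ : Γ) : R) ^ n) ∘
      (Subtype.val : ↥s → _) = (fun n : Fin k → Fin p => ∏ i, bv i ^ (n i : ℕ)) ∘ φ := by
    funext b
    simp only [Function.comp_apply]
    rw [Finsupp.prod_of_support_subset _ (hsub b.1 b.2) _ (fun γ _ => pow_zero _),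
      ← Finset.prod_coe_sort G, ← Equiv.prod_comp e.symm]
  rw [heq]
  exact hli.comp φ hφ

section Frobenius

variable [Fact p.Prime] [CharP R p]

/-- **The reduced monomials of a `p`-basis over `R^p` span `R` over `R^p`.** For
`IsPBasisOver p R^p Γ` with `R^p` the range of Frobenius: the `R^p`-span `M` of the reduced monomials
contains `1` and is stable under multiplication by every `γ ∈ Γ` (`γ · Γ^b = Γ^{b + e_γ}` if
`b γ + 1 < p`, else `= γ^p · Γ^{b − (p−1)e_γ}` with `γ^p ∈ R^p`), hence under `R^p[Γ] = R`: `M = R`.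
[cite: KimuraNiitsuma1980, p. 363 l. 7–10] -/
theorem IsPBasisOver.span_monomial_eq_top {Γ : Set R} (h : IsPBasisOver p (frobenius R p).range Γ) :
    Submodule.span (frobenius R p).range
      (Set.range fun b : {b : Γ →₀ ℕ // ∀ γ, b γ < p} => (b.1).prod fun γ n => ((γ : Γ) : R) ^ n) =
      ⊤ := by
  classical
  have hp : p.Prime := Fact.out
  set R' := (frobenius R p).range with hR'
  set mon : {b : Γ →₀ ℕ // ∀ γ, b γ < p} → R := fun b => (b.1).prod fun γ n => ((γ : Γ) : R) ^ n
    with hmon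
  set M := Submodule.span R' (Set.range mon) with hM
  -- `1 ∈ M`
  have h1 : (1 : R) ∈ M := by
    have : mon ⟨0, fun _ => hp.pos⟩ = 1 := by simp [hmon]
    rw [← this]
    exact Submodule.subset_span ⟨_, rfl⟩
  -- `γ · mon b ∈ M`
  have hγmon : ∀ (γ : Γ) (b : {b : Γ →₀ ℕ // ∀ γ, b γ < p}), ((γ : Γ) : R) * mon b ∈ M := by
    intro γ b
    by_cases hlt : b.1 γ + 1 < p
    · -- `γ · Γ^b = Γ^{b + e_γ}`
      let b' : {b : Γ →₀ ℕ // ∀ γ, b γ < p} := ⟨b.1 + Finsupp.single γ 1, fun δ => by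
        by_cases hδ : δ = γ
        · subst hδ; simpa using hlt
        · rw [Finsupp.add_apply, Finsupp.single_eq_of_ne hδ, add_zero]; exact b.2 δ⟩
      have e : ((γ : Γ) : R) * mon b = mon b' := by
        simp only [hmon]
        rw [Finsupp.prod_add_index' (h := fun (γ : Γ) (n : ℕ) => ((γ : Γ) : R) ^ n)
          (fun _ => pow_zero _) (fun _ _ _ => pow_add _ _ _),
          Finsupp.prod_single_index (h := fun (δ : Γ) (n : ℕ) => ((δ : Γ) : R) ^ n) (pow_zero _),
          pow_one, mul_comm]
      rw [e]
      exact Submodule.subset_span ⟨_, rfl⟩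
    · -- `b γ = p - 1`: `γ · Γ^b = γ^p · Γ^{b - (p-1)e_γ}`
      have hbγ : b.1 γ = p - 1 := by have := b.2 γ; omega
      let b' : {b : Γ →₀ ℕ // ∀ γ, b γ < p} := ⟨b.1.erase γ, fun δ => by
        by_cases hδ : δ = γ
        · subst hδ; rw [Finsupp.erase_same]; exact hp.pos
        · rw [Finsupp.erase_ne hδ]; exact b.2 δ⟩
      have hγsupp : γ ∈ b.1.support := by
        rw [Finsupp.mem_support_iff, hbγ]; have := hp.two_le; omega
      have e : ((γ : Γ) : R) * mon b = ((γ : Γ) : R) ^ p * mon b' := by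
        simp only [hmon]
        rw [← Finsupp.mul_prod_erase b.1 γ _ hγsupp, hbγ, ← mul_assoc, ← pow_succ',
          Nat.sub_add_cancel hp.one_le]
      rw [e]
      have hmem : ((γ : Γ) : R) ^ p ∈ R' := ⟨(γ : R), frobenius_def ..⟩
      exact M.smul_mem (⟨_, hmem⟩ : R') (Submodule.subset_span ⟨b', rfl⟩)
  -- `M` is stable under multiplication by `Γ`, hence by `R = R′[Γ]`
  have hΓM : ∀ (γ : Γ), ∀ v ∈ M, ((γ : Γ) : R) * v ∈ M := by
    intro γ v hv
    refine Submodule.span_induction ?_ ?_ ?_ ?_ hv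
    · rintro _ ⟨b, rfl⟩
      exact hγmon γ b
    · rw [mul_zero]; exact M.zero_mem
    · intro a b _ _ ha hb
      rw [mul_add]; exact M.add_mem ha hb
    · intro c a _ ha
      rw [mul_smul_comm]; exact M.smul_mem c ha
  have hall : ∀ r : R, ∀ v ∈ M, r * v ∈ M := by
    intro r
    have hr : r ∈ Algebra.adjoin R' Γ := by rw [h.1]; trivial
    refine Algebra.adjoin_induction ?_ ?_ ?_ ?_ hr
    · intro γ hγ v hv
      exact hΓM ⟨γ, hγ⟩ v hv
    · intro c v hv
      rw [Algebra.algebraMap_eq_smul_one, smul_mul_assoc, one_mul]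
      exact M.smul_mem c hv
    · intro a b _ _ ha hb v hv
      rw [add_mul]; exact M.add_mem (ha v hv) (hb v hv)
    · intro a b _ _ ha hb v hv
      rw [mul_assoc]; exact ha _ (hb v hv)
  rw [eq_top_iff]
  intro f _
  simpa using hall f 1 h1

/-- **Giraud's expansion (§1.4 (2)) along a `p`-basis**: for `IsPBasisOver p R^p Γ`, every `f ∈ R`
is a finite sum `f = Σ_b c_b · Γ^b` over reduced exponent vectors `b`, with `c_b ∈ R^p` — i.e.
`f = Σ f_b^p Γ^b`. (Uniqueness of the coefficients: `IsPBasisOver.linearIndependent_monomial`.)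
[cite: Giraud1983, 1.4 (2)] -/
theorem IsPBasisOver.exists_monomial_expansion {Γ : Set R}
    (h : IsPBasisOver p (frobenius R p).range Γ) (f : R) :
    ∃ c : {b : Γ →₀ ℕ // ∀ γ, b γ < p} →₀ (frobenius R p).range,
      (c.sum fun b r => (r : R) * (b.1).prod fun γ n => ((γ : Γ) : R) ^ n) = f := by
  have hf : f ∈ Submodule.span (frobenius R p).range
      (Set.range fun b : {b : Γ →₀ ℕ // ∀ γ, b γ < p} =>
        (b.1).prod fun γ n => ((γ : Γ) : R) ^ n) := by
    rw [IsPBasisOver.span_monomial_eq_top h]; trivial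
  obtain ⟨c, hc⟩ := (Finsupp.mem_span_range_iff_exists_finsupp).mp hf
  exact ⟨c, by simpa [Subring.smul_def] using hc⟩

end Frobenius

end Summit.ResolutionOfSingularities.ResolutionOfSingularities.Theorems.RadicialJung.CleanModels

end
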